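import Literature.Computability.MetaComplexity.CuttingPlanesSplit
import Literature.Computability.Complexity.MonotoneBlockPrograms
import HarnessLib

/-!
# Cutting planes interpolation, II: the unary bit layout of the splitting recursion

The circuit half of feasible MONOTONE interpolation for cutting planes with small coefficients
(Pudlák 1997, Thm. 3; Bonet–Pitassi–Raz 1997, §4): the clamped recursion `(dz, uz)` of
`CuttingPlanesSplit.lean` is written as a bitwise monotone recursion (`BlockProg` specification,
`MonotoneBlockPrograms.lean`) in UNARY: every integer `d ∈ [-W, W]` (`W = cpNorm π`) is carried by
its threshold bits `[d ≥ t]`, `-W < t ≤ W`, on which addition, multiplication and rounded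
division by constants, clamping and the counting of true shared variables in an axiom are
monotone `{∧, ∨}`-formulas of size `O(W)`.

This file fixes the LAYOUT and the FORMULAS: line `k` of the derivation owns the bit slots
`k U … k U + U - 1` (`CPBits.U W = (W+1) W + 4 W + 3`), split into a counter region
(`cntSlot`, `(W+1) × W` bits counting the true negated shared variables of a `B`-axiom), the raw
threshold bits (`rawSlot`, thresholds `-W < t ≤ W + 1`), the clamped value bits (`valSlot`,
`-W < t ≤ W`), the flag (`flagSlot`) and the interpolant bit (`outSlot`); `CPBits.spec` is the
specification and `CPBits.spec_cntSlot` / `…_rawSlot` / `…_valSlot` / `…_flagSlot` /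
`…_outSlot` decode it.  The semantic correspondence and the theorem are in
`CuttingPlanesInterpolation.lean`.

## References

* P. Pudlák, J. Symbolic Logic 62 (1997), Thm. 3 [Pudlak1997].
* M. Bonet, T. Pitassi, R. Raz, J. Symbolic Logic 62 (1997), §4 [BonetPitassiRaz1997].
-/

namespace Literature.Computability.MetaComplexity

open Finset Literature.Computability.Complexity CPLine MForm

namespace CPBits

variable {X Y Z : Type*}

/-! ### The layout -/

/-- Size of the counter region of a line: `(W + 1) W` bits `cnt q r`, `q ≤ W`, `1 ≤ r ≤ W`.
[folklore] -/
def nC (W : ℕ) : ℕ := (W + 1) * W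

/-- Offset of the raw threshold bits (`2 W + 1` of them). [folklore] -/
def offRaw (W : ℕ) : ℕ := nC W

/-- Offset of the clamped value bits (`2 W` of them). [folklore] -/
def offVal (W : ℕ) : ℕ := nC W + (2 * W + 1)

/-- Offset of the flag bit. [folklore] -/
def offFlag (W : ℕ) : ℕ := nC W + (4 * W + 1)

/-- Offset of the interpolant bit. [folklore] -/
def offOut (W : ℕ) : ℕ := nC W + (4 * W + 2)

/-- Number of bit slots per line. [folklore] -/
def U (W : ℕ) : ℕ := nC W + (4 * W + 3)

/-- The index of an integer threshold `t > -W` inside a threshold region. [folklore] -/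
def tIdx (W : ℕ) (t : ℤ) : ℕ := (t + W - 1).toNat

/-- Slot of the counter bit `cnt q r` of line `k`. [folklore] -/
def cntSlot (W k q r : ℕ) : ℕ := k * U W + (q * W + (r - 1))

/-- Slot of the raw threshold bit `[raw ≥ t]` of line `k`. [folklore] -/
def rawSlot (W k : ℕ) (t : ℤ) : ℕ := k * U W + (offRaw W + tIdx W t)

/-- Slot of the value bit `[dz ≥ t]` of line `k`. [folklore] -/
def valSlot (W k : ℕ) (t : ℤ) : ℕ := k * U W + (offVal W + tIdx W t)

/-- Slot of the flag bit of line `k`. [folklore] -/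
def flagSlot (W k : ℕ) : ℕ := k * U W + offFlag W

/-- Slot of the interpolant bit of line `k`. [folklore] -/
def outSlot (W k : ℕ) : ℕ := k * U W + offOut W

/-! ### Reference formulas with out-of-window conventions -/

/-- Reference to the value bit `[dz_k ≥ t]` for any integer `t`: `true` below the window,
`false` above. [folklore] -/
def valRef (W k : ℕ) (t : ℤ) : MForm X :=
  if t ≤ -(W : ℤ) then tt else if (W : ℤ) < t then ff else bit (valSlot W k t)

/-- Reference to the counter bit `cnt q r` of line `k` for any natural `r`: `true` for `r = 0`,
`false` for `r > W`. [folklore] -/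
def cntRef (W k q r : ℕ) : MForm X :=
  if r = 0 then tt else if W < r then ff else bit (cntSlot W k q r)

/-- Reference to the raw bit `[raw_k ≥ t]` (thresholds `-W < t ≤ W + 1` only). [folklore] -/
def rawRef (W k : ℕ) (t : ℤ) : MForm X := bit (rawSlot W k t)

/-- Reference to the flag of line `k`. [folklore] -/
def flagRef (W k : ℕ) : MForm X := bit (flagSlot W k)

/-! ### The shared variables of a line -/

/-- The shared variables occurring in a line, listed once each (in an arbitrary order).
[folklore] -/
noncomputable def xsOf (L : CPLine (X ⊕ (Y ⊕ Z))) : List X :=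
  L.coeff.support.toList.filterMap Sum.getLeft?

/-- `xsOf` lists exactly the shared variables with a nonzero coefficient. [folklore] -/
theorem mem_xsOf {L : CPLine (X ⊕ (Y ⊕ Z))} {x : X} : x ∈ xsOf L ↔ L.coeff (Sum.inl x) ≠ 0 := by
  unfold xsOf
  simp only [List.mem_filterMap, Finset.mem_toList, Finsupp.mem_support_iff, Sum.getLeft?_eq_some_iff]
  constructor
  · rintro ⟨v, hv, rfl⟩; exact hv
  · intro h; exact ⟨_, h, rfl⟩

/-- `xsOf` has no duplicates. [folklore] -/
theorem nodup_xsOf (L : CPLine (X ⊕ (Y ⊕ Z))) : (xsOf L).Nodup := by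
  unfold xsOf
  refine (Finset.nodup_toList _).filterMap fun v w x hv hw => ?_
  rw [Option.mem_def, Sum.getLeft?_eq_some_iff] at hv hw
  rw [hv, hw]

/-- The number of listed shared variables is at most the norm of the line (each has a
coefficient of absolute value `≥ 1`). [folklore] -/
theorem length_xsOf_le_norm (L : CPLine (X ⊕ (Y ⊕ Z))) : (xsOf L).length ≤ L.norm := by
  refine le_trans ?_ L.sum_natAbs_le_norm
  unfold xsOf Finsupp.sum
  calc (L.coeff.support.toList.filterMap Sum.getLeft?).length
      ≤ L.coeff.support.toList.length := List.length_filterMap_le _ _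
    _ = ∑ v ∈ L.coeff.support, 1 := by simp
    _ ≤ ∑ v ∈ L.coeff.support, (L.coeff v).natAbs :=
        Finset.sum_le_sum fun v hv => Int.natAbs_pos.2 (Finsupp.mem_support_iff.1 hv)

/-- The count of true listed shared variables among the first `q`. [folklore] -/
def cntTrue (a : X → Bool) (xs : List X) (q : ℕ) : ℕ := ((xs.take q).filter fun x => a x).length

/-- One more listed variable. [folklore] -/
theorem cntTrue_succ (a : X → Bool) (xs : List X) {q : ℕ} (hq : q < xs.length) :
    cntTrue a xs (q + 1) = cntTrue a xs q + (if a (xs[q]'hq) then 1 else 0) := by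
  unfold cntTrue
  rw [List.take_add_one, List.getElem?_eq_getElem hq, Option.toList_some, List.filter_append,
    List.length_append]
  congr 1
  by_cases h : a (xs[q]'hq) = true <;> simp [h]

/-- Beyond the list the count is constant. [folklore] -/
theorem cntTrue_succ_of_le (a : X → Bool) (xs : List X) {q : ℕ} (hq : xs.length ≤ q) :
    cntTrue a xs (q + 1) = cntTrue a xs q := by
  unfold cntTrue
  rw [List.take_of_length_le hq, List.take_of_length_le (by omega)]

/-- The count is at most `q`. [folklore] -/
theorem cntTrue_le (a : X → Bool) (xs : List X) (q : ℕ) : cntTrue a xs q ≤ q := by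
  unfold cntTrue
  exact (List.length_filter_le _ _).trans (by simp)

/-- The full count. [folklore] -/
theorem cntTrue_of_length_le (a : X → Bool) (xs : List X) {q : ℕ} (hq : xs.length ≤ q) :
    cntTrue a xs q = (xs.filter fun x => a x).length := by
  unfold cntTrue; rw [List.take_of_length_le hq]

/-! ### The specification -/

section Spec

variable (A : CNF (X ⊕ (Y ⊕ Z))) (π : List (CPStep (X ⊕ (Y ⊕ Z)))) (W : ℕ)

/-- `valRef` has size `1`. [folklore] -/
@[simp] theorem size_valRef (k : ℕ) (t : ℤ) : (valRef W k t : MForm X).size = 1 := by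
  unfold valRef; split_ifs <;> rfl

/-- `cntRef` has size `1`. [folklore] -/
@[simp] theorem size_cntRef (k q r : ℕ) : (cntRef W k q r : MForm X).size = 1 := by
  unfold cntRef; split_ifs <;> rfl

/-- The counter bits of line `k`: `cnt 0 r = 0`; `cnt (q+1) r = cnt q r ∨ (cnt q (r-1) ∧ x_q)`
while `q` runs through the listed shared variables of the line, a copy afterwards.
[cite: BonetPitassiRaz1997, §4] -/
noncomputable def cntSpec (k q r : ℕ) : MForm X :=
  match π[k]? with
  | none => ff
  | some s =>
    match q with
    | 0 => ff
    | q + 1 =>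
      if h : q < (xsOf s.line).length then
        or (cntRef W k q r) (and (cntRef W k q (r - 1)) (input ((xsOf s.line)[q]'h)))
      else cntRef W k q r

/-- The clamped value bit `[dz ≥ t]` of line `k`: constant outside the window `[-Wz, Wz]`, the
raw bit inside. [cite: BonetPitassiRaz1997, §4] -/
noncomputable def valSpec (k : ℕ) (t : ℤ) : MForm X :=
  if t ≤ -CPSplit.Wz π k then tt else if CPSplit.Wz π k < t then ff else rawRef W k t

/-- The OR of the flags of the premises of line `k`. [cite: BonetPitassiRaz1997, §4] -/
noncomputable def premFlags (k : ℕ) : MForm X :=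
  match π[k]? with
  | none => ff
  | some s =>
    match s.rule with
    | .add i j => or (flagRef W i) (flagRef W j)
    | .mul _ i => flagRef W i
    | .div _ i => flagRef W i
    | _ => ff

/-- The flag of line `k`: a premise flag, or overflow of the raw value beyond `Wz`.
[cite: BonetPitassiRaz1997, §4] -/
noncomputable def flagSpec (k : ℕ) : MForm X :=
  or (premFlags π W k) (rawRef W k (CPSplit.Wz π k + 1))

/-- The interpolant bit of line `k`: flag, or value `≥ 1`. [cite: Pudlak1997, Thm. 3] -/
noncomputable def outSpec (k : ℕ) : MForm X :=
  or (flagRef W k) (valRef W k 1)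

/-- The counter formulas are small. [folklore] -/
theorem size_cntSpec (k q r : ℕ) : (cntSpec π W k q r : MForm X).size ≤ 5 := by
  unfold cntSpec
  rcases π[k]? with _ | s
  · simp [MForm.size]
  · cases q with
    | zero => simp [MForm.size]
    | succ q =>
      dsimp only
      split_ifs
      · simp [MForm.size]
      · simp

/-- The value formulas have size `1`. [folklore] -/
theorem size_valSpec (k : ℕ) (t : ℤ) : (valSpec π W k t : MForm X).size = 1 := by
  unfold valSpec rawRef; split_ifs <;> rfl

/-- The flag formulas have size `≤ 5`. [folklore] -/
theorem size_flagSpec (k : ℕ) : (flagSpec π W k : MForm X).size ≤ 5 := by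
  unfold flagSpec premFlags rawRef flagRef
  rcases π[k]? with _ | s
  · simp [MForm.size]
  · dsimp only
    rcases s.rule with _ | v | v | ⟨i, j⟩ | ⟨c, i⟩ | ⟨c, i⟩ <;> simp [MForm.size]

/-- The interpolant formulas have size `3`. [folklore] -/
theorem size_outSpec (k : ℕ) : (outSpec W k : MForm X).size = 3 := by
  unfold outSpec flagRef; simp [MForm.size]

variable [DecidableEq X] [DecidableEq Y] [DecidableEq Z]

open Classical in
/-- The raw threshold bit `[raw ≥ t]` of line `k`, by the rule of the line (unary arithmetic on
the value bits of the premises; the counter for a `B`-axiom). [cite: BonetPitassiRaz1997, §4] -/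
noncomputable def rawSpec (k : ℕ) (t : ℤ) : MForm X :=
  match π[k]? with
  | none => ff
  | some s =>
    match s.rule with
    | .initial =>
      if ∃ C ∈ A, s.line = ofClause C then ofBool (decide (t ≤ 0))
      else
        -- `[const + #true negated x ≥ t]`
        if t - s.line.const ≤ 0 then tt
        else if (W : ℤ) < t - s.line.const then ff
        else cntRef W k W (t - s.line.const).toNat
    | .lower v => ofBool (decide (t ≤ Sum.elim (fun _ => (0 : ℤ)) (Sum.elim (fun _ => 0) (fun _ => s.line.const)) v))
    | .upper v => ofBool (decide (t ≤ Sum.elim (fun _ => (0 : ℤ)) (Sum.elim (fun _ => 0) (fun _ => s.line.const)) v))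
    | .add i j =>
      disj ((List.range (2 * W + 1)).map fun n : ℕ =>
        and (valRef W i ((n : ℤ) - W)) (valRef W j (t - ((n : ℤ) - W))))
    | .mul c i => if c = 0 then ofBool (decide (t ≤ 0)) else valRef W i (ceilDiv t c)
    | .div c i => valRef W i ((c : ℤ) * (t - 1) + 1)

/-- The specification of the bits of line `k`, by position inside the line.
[cite: BonetPitassiRaz1997, §4] -/
noncomputable def lineSpec (k u : ℕ) : MForm X :=
  if u < nC W then cntSpec π W k (u / W) (u % W + 1)
  else if u < nC W + (2 * W + 1) then rawSpec A π W k (((u - nC W : ℕ) : ℤ) - W + 1)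
  else if u < nC W + (4 * W + 1) then valSpec π W k (((u - nC W - (2 * W + 1) : ℕ) : ℤ) - W + 1)
  else if u = nC W + (4 * W + 1) then flagSpec π W k
  else outSpec W k

/-- **The specification**: bit slot `s` belongs to line `s / U` at position `s % U`.
[cite: BonetPitassiRaz1997, §4] -/
noncomputable def spec (s : ℕ) : MForm X := lineSpec A π W (s / U W) (s % U W)

/-! ### Decoding the slots -/

/-- `U > 0`. [folklore] -/
theorem U_pos : 0 < U W := by unfold U; omega

/-- Slots of line `k` decode to line `k`. [folklore] -/
theorem spec_line {k u : ℕ} (hu : u < U W) : spec A π W (k * U W + u) = lineSpec A π W k u := by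
  unfold spec
  rw [Nat.add_comm, Nat.add_mul_div_right _ _ (U_pos W), Nat.div_eq_of_lt hu, Nat.zero_add,
    Nat.add_mul_mod_self_right, Nat.mod_eq_of_lt hu]

/-- The counter slots decode to the counter specification. [folklore] -/
theorem spec_cntSlot {k q r : ℕ} (hq : q ≤ W) (hr : 1 ≤ r) (hrW : r ≤ W) :
    spec A π W (cntSlot W k q r) = cntSpec π W k q r := by
  unfold cntSlot
  have hlt : q * W + (r - 1) < nC W := by
    unfold nC
    have h1 : q * W ≤ W * W := Nat.mul_le_mul_right _ hq
    have h2 : (W + 1) * W = W * W + W := by ring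
    have h3 : r - 1 < W := by omega
    rw [h2]; exact Nat.add_lt_add_of_le_of_lt h1 h3
  rw [spec_line A π W (by unfold U; omega)]
  unfold lineSpec
  rw [if_pos hlt, Nat.add_comm, Nat.add_mul_div_right _ _ (by omega), Nat.div_eq_of_lt (by omega),
    Nat.zero_add, Nat.add_mul_mod_self_right, Nat.mod_eq_of_lt (by omega), Nat.sub_add_cancel hr]

/-- The raw slots decode to the raw specification. [folklore] -/
theorem spec_rawSlot {k : ℕ} {t : ℤ} (ht : -(W : ℤ) + 1 ≤ t) (ht' : t ≤ W + 1) :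
    spec A π W (rawSlot W k t) = rawSpec A π W k t := by
  unfold rawSlot offRaw tIdx
  have h1 : (t + W - 1).toNat < 2 * W + 1 := by
    have : ((t + W - 1).toNat : ℤ) = t + W - 1 := Int.toNat_of_nonneg (by omega)
    omega
  rw [spec_line A π W (by unfold U; omega)]
  unfold lineSpec
  rw [if_neg (by omega), if_pos (by omega)]
  congr 1
  rw [Nat.add_sub_cancel_left, Int.toNat_of_nonneg (by omega)]
  ring

/-- The value slots decode to the value specification. [folklore] -/
theorem spec_valSlot {k : ℕ} {t : ℤ} (ht : -(W : ℤ) + 1 ≤ t) (ht' : t ≤ W) :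
    spec A π W (valSlot W k t) = valSpec π W k t := by
  unfold valSlot offVal tIdx
  have h1 : (t + W - 1).toNat < 2 * W := by
    have : ((t + W - 1).toNat : ℤ) = t + W - 1 := Int.toNat_of_nonneg (by omega)
    omega
  rw [spec_line A π W (by unfold U; omega)]
  unfold lineSpec
  rw [if_neg (by omega), if_neg (by omega), if_pos (by omega)]
  congr 1
  rw [show nC W + (2 * W + 1) + (t + ↑W - 1).toNat - nC W - (2 * W + 1) = (t + W - 1).toNat by omega,
    Int.toNat_of_nonneg (by omega)]
  ring

/-- The flag slot decodes to the flag specification. [folklore] -/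
theorem spec_flagSlot (k : ℕ) : spec A π W (flagSlot W k) = flagSpec π W k := by
  unfold flagSlot offFlag
  rw [spec_line A π W (by unfold U; omega)]
  unfold lineSpec
  rw [if_neg (by omega), if_neg (by omega), if_neg (by omega), if_pos rfl]

/-- The interpolant slot decodes to the interpolant specification. [folklore] -/
theorem spec_outSlot (k : ℕ) : spec A π W (outSlot W k) = outSpec W k := by
  unfold outSlot offOut
  rw [spec_line A π W (by unfold U; omega)]
  unfold lineSpec
  rw [if_neg (by omega), if_neg (by omega), if_neg (by omega), if_neg (by omega)]

/-! ### Ordering of the slots (references go to earlier slots) -/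

/-- Counter slots of line `k` precede its raw slots. [folklore] -/
theorem cntSlot_lt_rawSlot {k q r : ℕ} (hq : q ≤ W) (hr : 1 ≤ r) (hrW : r ≤ W) (t : ℤ) :
    cntSlot W k q r < rawSlot W k t := by
  unfold cntSlot rawSlot offRaw nC
  have h1 : q * W ≤ W * W := Nat.mul_le_mul_right _ hq
  have h2 : (W + 1) * W = W * W + W := by ring
  have h3 : r - 1 < W := by omega
  rw [h2]
  exact Nat.add_lt_add_left (Nat.lt_of_lt_of_le (Nat.add_lt_add_of_le_of_lt h1 h3) (Nat.le_add_right _ _)) _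

/-- Counter slots increase with `q`. [folklore] -/
theorem cntSlot_lt_cntSlot_succ {k q r r' : ℕ} (hr : 1 ≤ r) (hrW : r ≤ W) (hr' : 1 ≤ r') :
    cntSlot W k q r < cntSlot W k (q + 1) r' := by
  unfold cntSlot
  rw [Nat.succ_mul]
  omega

/-- Raw slots of line `k` precede its value slots. [folklore] -/
theorem rawSlot_lt_valSlot {k : ℕ} {t t' : ℤ} (ht' : t ≤ (W : ℤ) + 1) (ht'' : -(W : ℤ) + 1 ≤ t') :
    rawSlot W k t < valSlot W k t' := by
  unfold rawSlot valSlot offRaw offVal tIdx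
  have h1 : (t + W - 1).toNat ≤ 2 * W := by
    rcases le_or_gt 0 (t + W - 1) with h | h
    · have : ((t + W - 1).toNat : ℤ) = t + W - 1 := Int.toNat_of_nonneg h; omega
    · rw [Int.toNat_of_nonpos h.le]; omega
  omega

/-- Raw slots of line `k` precede its flag slot. [folklore] -/
theorem rawSlot_lt_flagSlot {k : ℕ} {t : ℤ} (ht' : t ≤ (W : ℤ) + 1) : rawSlot W k t < flagSlot W k := by
  unfold rawSlot flagSlot offRaw offFlag tIdx
  have h1 : (t + W - 1).toNat ≤ 2 * W := by
    rcases le_or_gt 0 (t + W - 1) with h | h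
    · have : ((t + W - 1).toNat : ℤ) = t + W - 1 := Int.toNat_of_nonneg h; omega
    · rw [Int.toNat_of_nonpos h.le]; omega
  omega

/-- Value slots of line `k` precede its interpolant slot. [folklore] -/
theorem valSlot_lt_outSlot {k : ℕ} {t : ℤ} (ht' : t ≤ (W : ℤ)) : valSlot W k t < outSlot W k := by
  unfold valSlot outSlot offVal offOut tIdx
  have h1 : (t + W - 1).toNat ≤ 2 * W - 1 := by
    rcases le_or_gt 0 (t + W - 1) with h | h
    · have : ((t + W - 1).toNat : ℤ) = t + W - 1 := Int.toNat_of_nonneg h; omega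
    · rw [Int.toNat_of_nonpos h.le]; omega
  omega

/-- The flag slot of line `k` precedes its interpolant slot. [folklore] -/
theorem flagSlot_lt_outSlot (k : ℕ) : flagSlot W k < outSlot W k := by
  unfold flagSlot outSlot offFlag offOut; omega

/-- All slots of line `i` precede all slots of line `k > i`. [folklore] -/
theorem slot_lt_of_lt {i k u u' : ℕ} (hik : i < k) (hu : u < U W) : i * U W + u < k * U W + u' := by
  have : (i + 1) * U W ≤ k * U W := Nat.mul_le_mul_right _ hik
  rw [Nat.succ_mul] at this
  omega

/-- A value slot is inside its line. [folklore] -/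
theorem valSlot_lt {i : ℕ} {t : ℤ} (ht' : t ≤ (W : ℤ)) (k : ℕ) (hik : i < k) (u' : ℕ) :
    valSlot W i t < k * U W + u' := by
  unfold valSlot
  refine slot_lt_of_lt W hik ?_
  unfold offVal U tIdx
  have h1 : (t + W - 1).toNat ≤ 2 * W - 1 := by
    rcases le_or_gt 0 (t + W - 1) with h | h
    · have : ((t + W - 1).toNat : ℤ) = t + W - 1 := Int.toNat_of_nonneg h; omega
    · rw [Int.toNat_of_nonpos h.le]; omega
  omega

/-- A flag slot is inside its line. [folklore] -/
theorem flagSlot_lt {i : ℕ} (k : ℕ) (hik : i < k) (u' : ℕ) : flagSlot W i < k * U W + u' := by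
  unfold flagSlot
  exact slot_lt_of_lt W hik (by unfold offFlag U; omega)

/-! ### Sizes of the formulas -/

/-- The raw formulas have size `≤ 8 W + 5`. [folklore] -/
theorem size_rawSpec (k : ℕ) (t : ℤ) : (rawSpec A π W k t : MForm X).size ≤ 8 * W + 5 := by
  unfold rawSpec
  rcases π[k]? with _ | s
  · simp [MForm.size]
  · dsimp only
    rcases s.rule with _ | v | v | ⟨i, j⟩ | ⟨c, i⟩ | ⟨c, i⟩ <;> dsimp only
    · split_ifs <;> simp [MForm.size]
    · simp
    · simp
    · refine (size_disj_le (c := 3) fun f hf => ?_).trans ?_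
      · obtain ⟨n, -, rfl⟩ := List.mem_map.1 hf
        simp [MForm.size]
      · rw [List.length_map, List.length_range]; omega
    · split_ifs <;> simp
    · simp

/-- **Every formula of the specification has size `≤ 8 W + 5`**, so `P = 8 W + 6` gates per
slot suffice. [folklore] -/
theorem size_spec_succ_le (s : ℕ) : (spec A π W s : MForm X).size + 1 ≤ 8 * W + 6 := by
  unfold spec lineSpec
  split_ifs
  · linarith [size_cntSpec π W (s / U W) (s % U W / W) (s % U W % W + 1) (X := X)]
  · linarith [size_rawSpec A π W (s / U W) (((s % U W - nC W : ℕ) : ℤ) - W + 1)]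
  · rw [size_valSpec]; omega
  · linarith [size_flagSpec π W (s / U W) (X := X)]
  · rw [size_outSpec]; omega

end Spec

end CPBits

end Literature.Computability.MetaComplexity
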